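import Summits.AtomisticToContinuum.HydrodynamicLimit.Theorems.CollisionIsometryCLTAdaptedWeightCLTBHFewCollisionsCount
import Literature.MathematicalPhysics.KineticTheory.HardSphereMeanCollisionCount
import Summits.AtomisticToContinuum.HydrodynamicLimit.Theorems.JParityClosureOddContactSymmetryGibbsInvariance
import Summits.AtomisticToContinuum.HydrodynamicLimit.Theorems.JParityClosureCollisionTightnessSweptTube
import Summits.AtomisticToContinuum.HydrodynamicLimit.Theorems.JParityClosureCollisionTightnessTorusGibbs

/-!
# Equilibrium rung of `stub_fewCollisions` (S0 of the line `block-h-dissipation-closure`, crux `AdaptedWeightCLT`,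
# stmt-AtomisticToContinuum-14868): few collisions at constant profiles, for every flow and every horizon

Support file (`--supports stmt-AtomisticToContinuum-14868`, helper anchor `bhFewCollisions_eqRung_anchor`) of the
stub worker of `stub_fewCollisions`. MAIN RESULT (`fewCollisionsOn_const`): at CONSTANT profiles
`(a₀, θ₀, u₀) ≡ (a, θ, u)`, `0 < a`, `0 < θ`, for every `0 < σ < 1/2`, EVERY hard-sphere flow family `Φ` and every
horizon `t > 0`,

  `FewCollisionsOn σ (fun _ => a) (fun _ => θ) (fun _ => u) Φ t`,

i.e. `∀ p > 0, P_N{(N+1)^{4/3+p} < collCount σ N (Φ N) t} → 0` under the homogeneous Gibbs law `G_N`, with NO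
hypothesis (no H2 `TailsOn`): the `m = 0` rung of S0 and the equilibrium consistency check that `collCount` is typed
at the kinetic scale `(N+1)^{4/3}`.

Proof (first moment + Markov, `tendsto_measure_gt_rpow_of_markSum`, generic in the mark). `G_N` is invariant under
every flow map (tree `measurePreserving_flow_localGibbsLaw_const`), so the mean collision-flux bound of
Cercignani–Illner–Pulvirenti 1994 App. 4.A (tree `localGibbsLaw_lintegral_le_of_le_collisionMarkSum`, with the tree
inputs: pair law `≤ 5 ×` Haar `posGibbs_pairEvent_le_five` for every `σ ≤ 1/2`, swept tubes `exists_sweptTube`,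
minimal-image lift `volume_setOf_exists_reprSym_add_latticeVec_mem_le`) gives, for every measurable mark `b` of two
velocities and every functional dominated on the good set by the collision sum of `b` over `[0, t]`,
`E_{G_N} ≤ 5 · 4t (N+1)² ε_N² · ∫ ‖w − v‖ b(v, w) dN(u,θ)^{⊗2} = 20 t σ² (N+1)^{4/3} · I_b` (`(N+1)² ε_N² = σ² (N+1)^{4/3}`,
`sq_mul_hsDiameter_sq`); Markov's inequality (a.e.-measurability of the functional) then bounds
`P_N{(N+1)^{4/3+p} < ·} ≤ 20 t σ² (N+1)^{-p} · I_b → 0` as soon as the Gaussian flux integral `I_b` is finite. For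
`collCount` the mark is `b = 1 + ‖v‖² + ‖w‖²` (domination `FewCollisions.ofReal_collCount_le_markSum`, measurability
`FewCollisions.aemeasurable_ofReal_collCount`, both in `…BHFewCollisionsCount`), whose flux integral is finite by the
Gaussian fourth moments (`lintegral_fluxMark_energy_ne_top`: `‖w − v‖ (1 + ‖v‖² + ‖w‖²) ≤ 3 (1 + ‖v‖⁴ + ‖w‖⁴)`). The same
three inputs for the mark `e^{λ'(‖v‖² + ‖w‖²)}`, `λ' < 1/(4θ)`, would give the exponentially-velocity-weighted variant.
No definitions are introduced (pure proof file).

References: C. Cercignani, R. Illner, M. Pulvirenti, *The Mathematical Theory of Dilute Gases* (1994), App. 4.A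
[CIPDiluteGases1994]; H. Spohn, *Large Scale Dynamics of Interacting Particles* (1991), Part I §2.3 [Spohn1991].
-/

namespace Summit.AtomisticToContinuum.HydrodynamicLimit.Theorems.BlockHDissipation

open scoped BigOperators Topology Classical MeasureTheory ENNReal InnerProductSpace
open Filter Set MeasureTheory ProbabilityTheory
open Literature.Analysis.FluidPDE
open Summit.AtomisticToContinuum.HydrodynamicLimit.Theorems.ContactSourceDuhamel (T3 V3 Cfg Vel Flow Flows)
open Summit.AtomisticToContinuum.HydrodynamicLimit.Theorems.ContactSourceDuhamel.TimeLocal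
open Literature.MathematicalPhysics.KineticTheory (gaussMeasure hsDiameter hsDiameter_le hsDiameter_pos localGibbsLaw
  localGibbsLaw_eq localGibbsLaw_absolutelyContinuous ae_mem_good_localGibbsLaw posGibbsMeasure
  posGibbs_pairEvent_le_five localGibbsLaw_lintegral_le_of_le_collisionMarkSum isProbabilityMeasure_localGibbsLaw)

noncomputable section

namespace FewCollisions

/-! ## Scales -/

/-- `(N+1)² ε_N² = σ² (N+1)^{4/3}` (`ε_N = σ (N+1)^{-1/3}`): the kinetic size of the mean collision-flux bound. -/
theorem sq_mul_hsDiameter_sq (σ : ℝ) (N : ℕ) :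
    ((N + 1 : ℕ) : ℝ) ^ 2 * hsDiameter σ N ^ 2 = σ ^ 2 * ((N + 1 : ℕ) : ℝ) ^ ((4 : ℝ) / 3) := by
  have hx : (0 : ℝ) < ((N + 1 : ℕ) : ℝ) := by positivity
  unfold hsDiameter
  rw [mul_pow, ← Real.rpow_natCast (((N + 1 : ℕ) : ℝ) ^ (-(1 / 3 : ℝ))) 2, ← Real.rpow_mul hx.le,
    ← Real.rpow_natCast ((N + 1 : ℕ) : ℝ) 2]
  have h : ((N + 1 : ℕ) : ℝ) ^ ((2 : ℕ) : ℝ) * ((N + 1 : ℕ) : ℝ) ^ (-(1 / 3 : ℝ) * ((2 : ℕ) : ℝ)) =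
      ((N + 1 : ℕ) : ℝ) ^ ((4 : ℝ) / 3) := by
    rw [← Real.rpow_add hx]
    norm_num
  calc ((N + 1 : ℕ) : ℝ) ^ ((2 : ℕ) : ℝ) * (σ ^ 2 * ((N + 1 : ℕ) : ℝ) ^ (-(1 / 3 : ℝ) * ((2 : ℕ) : ℝ)))
      = σ ^ 2 * (((N + 1 : ℕ) : ℝ) ^ ((2 : ℕ) : ℝ) * ((N + 1 : ℕ) : ℝ) ^ (-(1 / 3 : ℝ) * ((2 : ℕ) : ℝ))) := by ring
    _ = σ ^ 2 * ((N + 1 : ℕ) : ℝ) ^ ((4 : ℝ) / 3) := by rw [h]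

/-- The Markov ratio: `20 t (N+1)² ε_N² / (N+1)^{4/3+p} = 20 t σ² (N+1)^{-p}`. -/
theorem markov_ratio_eq (σ t p : ℝ) (N : ℕ) :
    20 * t * ((N + 1 : ℕ) : ℝ) ^ 2 * hsDiameter σ N ^ 2 / ((N + 1 : ℕ) : ℝ) ^ ((4 : ℝ) / 3 + p) =
      20 * t * σ ^ 2 * ((N + 1 : ℕ) : ℝ) ^ (-p) := by
  have hx : (0 : ℝ) < ((N + 1 : ℕ) : ℝ) := by positivity
  have h43 : 0 < ((N + 1 : ℕ) : ℝ) ^ ((4 : ℝ) / 3) := Real.rpow_pos_of_pos hx _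
  rw [mul_assoc (20 * t), sq_mul_hsDiameter_sq, Real.rpow_add hx, Real.rpow_neg hx.le]
  field_simp

/-- Negative powers of `N + 1` tend to zero (local copy of the lead's bookkeeping lemma). -/
theorem tendsto_natSucc_rpow_neg' {e : ℝ} (he : e < 0) :
    Tendsto (fun N : ℕ => ((N + 1 : ℕ) : ℝ) ^ e) atTop (𝓝 0) := by
  have hcast : Tendsto (fun N : ℕ => ((N + 1 : ℕ) : ℝ)) atTop atTop :=
    tendsto_natCast_atTop_atTop.comp (tendsto_add_atTop_nat 1)
  have h := (tendsto_rpow_neg_atTop (by linarith : 0 < -e)).comp hcast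
  simpa [Function.comp_def, neg_neg] using h

/-! ## The generic equilibrium rung: mean collision-flux bound + Markov -/

/-- **Mean bound under `G_N` for functionals dominated by a collision mark sum** (the tree's
`localGibbsLaw_lintegral_le_of_le_collisionMarkSum` with its three static inputs discharged, at the crux's diameters,
`N ≥ 1`, every `0 < σ ≤ 1/2`): `E_{G_N} f ≤ 5 · 4t(N+1)²ε_N² · I_b`. [cite: CIPDiluteGases1994, App. 4.A] -/
theorem lintegral_le_of_le_markSum {σ : ℝ} (hσ : 0 < σ) (hσ2 : σ ≤ 1 / 2) {a θ : ℝ} (ha : 0 < a) (hθ : 0 < θ)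
    (u : V3) {N : ℕ} (hN : 1 ≤ N) (Φ : Flow σ N) {t : ℝ} (ht : 0 < t) {b : V3 × V3 → ℝ≥0∞} (hbm : Measurable b)
    (f : Cfg N → ℝ≥0∞)
    (hf : ∀ z ∈ Φ.good, f z ≤ ∑ᶠ s ∈ collisionTimes (Torus.geometry (Fin 3)) (hsDiameter σ N)
          (fun r => Φ.flow r z) ∩ Icc 0 t,
        ∑ i : Fin (N + 1), ∑ j : Fin (N + 1),
          (if i ≠ j ∧ ‖(Torus.geometry (Fin 3)).sepVec (Φ.flow s z i).1 (Φ.flow s z j).1‖ = hsDiameter σ N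
            then b ((Φ.flow s z i).2, (Φ.flow s z j).2) else 0)) :
    ∫⁻ z, f z ∂(localGibbsLaw σ (fun _ => a) (fun _ => u) (fun _ => θ) N Φ) ≤
      5 * ENNReal.ofReal (4 * t * ((N + 1 : ℕ) : ℝ) ^ 2 * hsDiameter σ N ^ 2) *
        ∫⁻ p, ENNReal.ofReal ‖p.2 - p.1‖ * b p ∂((gaussMeasure u θ).prod (gaussMeasure u θ)) := by
  -- adapted from `mmr_energyCollisionFlux_const` (`…RelayRaceLocalityRestartPrincipleMmrEnergyHypConst`)
  have hε : 0 < hsDiameter σ N := hsDiameter_pos hσ N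
  have hpair : ∀ i j : Fin (N + 1), i ≠ j → ∀ T : Set T3, MeasurableSet T →
      posGibbsMeasure (fun _ : T3 => (1 : ℝ)) (hsDiameter σ N) (N + 1) {x | x i - x j ∈ T} ≤ 5 * volume T :=
    fun i j hij T hT => posGibbs_pairEvent_le_five hσ.le hσ2 hN hij hT
  have hlift : ∀ B : Set V3, MeasurableSet B →
      volume {x : T3 | ∃ k : Fin 3 → ℤ, Torus.reprSym x + Literature.Analysis.FunctionSpaces.Torus.latticeVec k ∈ B} ≤
        volume B := fun B hB => by
    simpa only [sub_zero] using volume_setOf_exists_reprSym_add_latticeVec_mem_le (0 : T3) hB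
  exact localGibbsLaw_lintegral_le_of_le_collisionMarkSum hσ2 ha hθ u Φ
    (measurePreserving_flow_localGibbsLaw_const σ a θ u N Φ) (Cp := 5) hpair (fun h hh => exists_sweptTube hε hh)
    hlift ht hbm f hf

/-- **Markov form at the kinetic scale.** Same setting; for a real functional `F` whose `ofReal` is
a.e.-measurable for `G_N` and dominated on the good set by the collision mark sum of `b` over `[0, t]`, and a level
`c > 0`: `G_N{c < F} ≤ ofReal (20 t (N+1)² ε_N² / c) · I_b`. -/
theorem measure_gt_le_of_le_markSum {σ : ℝ} (hσ : 0 < σ) (hσ2 : σ ≤ 1 / 2) {a θ : ℝ} (ha : 0 < a) (hθ : 0 < θ)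
    (u : V3) {N : ℕ} (hN : 1 ≤ N) (Φ : Flow σ N) {t : ℝ} (ht : 0 < t) {b : V3 × V3 → ℝ≥0∞} (hbm : Measurable b)
    (F : Cfg N → ℝ)
    (hFm : AEMeasurable (fun z => ENNReal.ofReal (F z)) (localGibbsLaw σ (fun _ => a) (fun _ => u) (fun _ => θ) N Φ))
    (hF : ∀ z ∈ Φ.good, ENNReal.ofReal (F z) ≤ ∑ᶠ s ∈ collisionTimes (Torus.geometry (Fin 3)) (hsDiameter σ N)
          (fun r => Φ.flow r z) ∩ Icc 0 t,
        ∑ i : Fin (N + 1), ∑ j : Fin (N + 1),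
          (if i ≠ j ∧ ‖(Torus.geometry (Fin 3)).sepVec (Φ.flow s z i).1 (Φ.flow s z j).1‖ = hsDiameter σ N
            then b ((Φ.flow s z i).2, (Φ.flow s z j).2) else 0))
    {c : ℝ} (hc : 0 < c) :
    localGibbsLaw σ (fun _ => a) (fun _ => u) (fun _ => θ) N Φ {z | c < F z} ≤
      ENNReal.ofReal (20 * t * ((N + 1 : ℕ) : ℝ) ^ 2 * hsDiameter σ N ^ 2 / c) *
        ∫⁻ p, ENNReal.ofReal ‖p.2 - p.1‖ * b p ∂((gaussMeasure u θ).prod (gaussMeasure u θ)) := by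
  set P := localGibbsLaw σ (fun _ => a) (fun _ => u) (fun _ => θ) N Φ with hP
  set I := ∫⁻ p, ENNReal.ofReal ‖p.2 - p.1‖ * b p ∂((gaussMeasure u θ).prod (gaussMeasure u θ)) with hI
  have hmean := lintegral_le_of_le_markSum hσ hσ2 ha hθ u hN Φ ht hbm _ hF
  have hc0 : ENNReal.ofReal c ≠ 0 := (ENNReal.ofReal_pos.2 hc).ne'
  have hsub : {z | c < F z} ⊆ {z | ENNReal.ofReal c ≤ ENNReal.ofReal (F z)} :=
    fun z hz => ENNReal.ofReal_le_ofReal (le_of_lt hz)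
  have hA : 5 * ENNReal.ofReal (4 * t * ((N + 1 : ℕ) : ℝ) ^ 2 * hsDiameter σ N ^ 2) =
      ENNReal.ofReal (20 * t * ((N + 1 : ℕ) : ℝ) ^ 2 * hsDiameter σ N ^ 2) := by
    rw [← ENNReal.ofReal_ofNat 5, ← ENNReal.ofReal_mul (by norm_num)]
    congr 1
    ring
  calc P {z | c < F z} ≤ P {z | ENNReal.ofReal c ≤ ENNReal.ofReal (F z)} := measure_mono hsub
    _ ≤ (∫⁻ z, ENNReal.ofReal (F z) ∂P) / ENNReal.ofReal c :=
        meas_ge_le_lintegral_div hFm hc0 ENNReal.ofReal_ne_top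
    _ ≤ (5 * ENNReal.ofReal (4 * t * ((N + 1 : ℕ) : ℝ) ^ 2 * hsDiameter σ N ^ 2) * I) / ENNReal.ofReal c := by
        gcongr
    _ = ENNReal.ofReal (20 * t * ((N + 1 : ℕ) : ℝ) ^ 2 * hsDiameter σ N ^ 2 / c) * I := by
        rw [hA, ENNReal.ofReal_div_of_pos hc, ENNReal.mul_div_right_comm]

/-- **THE GENERIC EQUILIBRIUM RUNG.** For `0 < σ < 1/2`, constant profiles `a, θ > 0`, `u`, a flow family `Φ`, a
horizon `t > 0`, a measurable mark `b` with FINITE Gaussian flux integral `I_b = ∫ ‖w − v‖ b(v,w) dN(u,θ)^{⊗2}`, and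
real functionals `F N` with `ofReal ∘ F N` a.e.-measurable for `G_N` and dominated on the good set by the collision sum
of `b` over `[0, t]`: for every `p > 0`, `G_N{(N+1)^{4/3+p} < F N} → 0` (it is `≤ 20 t σ² (N+1)^{-p} I_b` for `N ≥ 1`). -/
theorem tendsto_measure_gt_rpow_of_markSum {σ : ℝ} (hσ : 0 < σ) (hσ' : σ < 2⁻¹) {a θ : ℝ} (ha : 0 < a)
    (hθ : 0 < θ) (u : V3) (Φ : Flows σ) {t : ℝ} (ht : 0 < t) {b : V3 × V3 → ℝ≥0∞} (hbm : Measurable b)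
    (hI : ∫⁻ p, ENNReal.ofReal ‖p.2 - p.1‖ * b p ∂((gaussMeasure u θ).prod (gaussMeasure u θ)) ≠ ∞)
    (F : (N : ℕ) → Cfg N → ℝ)
    (hFm : ∀ N, AEMeasurable (fun z => ENNReal.ofReal (F N z))
      (localGibbsLaw σ (fun _ => a) (fun _ => u) (fun _ => θ) N (Φ N)))
    (hF : ∀ N, ∀ z ∈ (Φ N).good, ENNReal.ofReal (F N z) ≤
      ∑ᶠ s ∈ collisionTimes (Torus.geometry (Fin 3)) (hsDiameter σ N) (fun r => (Φ N).flow r z) ∩ Icc 0 t,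
        ∑ i : Fin (N + 1), ∑ j : Fin (N + 1),
          (if i ≠ j ∧ ‖(Torus.geometry (Fin 3)).sepVec ((Φ N).flow s z i).1 ((Φ N).flow s z j).1‖ = hsDiameter σ N
            then b (((Φ N).flow s z i).2, ((Φ N).flow s z j).2) else 0))
    {p : ℝ} (hp : 0 < p) :
    Tendsto (fun N : ℕ => localGibbsLaw σ (fun _ => a) (fun _ => u) (fun _ => θ) N (Φ N)
      {z | ((N + 1 : ℕ) : ℝ) ^ ((4 : ℝ) / 3 + p) < F N z}) atTop (𝓝 0) := by
  set I := ∫⁻ p, ENNReal.ofReal ‖p.2 - p.1‖ * b p ∂((gaussMeasure u θ).prod (gaussMeasure u θ)) with hIdef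
  have hσ2 : σ ≤ 1 / 2 := by rw [one_div]; exact hσ'.le
  -- the bound `ofReal (20 t σ² (N+1)^{-p}) · I → 0`
  have hlim : Tendsto (fun N : ℕ => ENNReal.ofReal (20 * t * σ ^ 2 * ((N + 1 : ℕ) : ℝ) ^ (-p)) * I)
      atTop (𝓝 0) := by
    have h1 : Tendsto (fun N : ℕ => 20 * t * σ ^ 2 * ((N + 1 : ℕ) : ℝ) ^ (-p)) atTop (𝓝 0) := by
      simpa using (tendsto_natSucc_rpow_neg' (by linarith : -p < 0)).const_mul (20 * t * σ ^ 2)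
    have h2 := ENNReal.tendsto_ofReal h1
    rw [ENNReal.ofReal_zero] at h2
    simpa using ENNReal.Tendsto.mul_const h2 (Or.inr hI)
  refine tendsto_of_tendsto_of_tendsto_of_le_of_le' tendsto_const_nhds hlim
    (Eventually.of_forall fun N => bot_le) ?_
  filter_upwards [eventually_ge_atTop 1] with N hN
  have hc : 0 < ((N + 1 : ℕ) : ℝ) ^ ((4 : ℝ) / 3 + p) := Real.rpow_pos_of_pos (by positivity) _
  have h := measure_gt_le_of_le_markSum hσ hσ2 ha hθ u hN (Φ N) ht hbm (F N) (hFm N) (hF N) hc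
  rwa [markov_ratio_eq] at h

/-! ## The energy mark `1 + ‖v‖² + ‖w‖²` -/

/-- The `ℝ≥0∞` energy mark of two velocities is measurable. -/
theorem measurable_energyMark :
    Measurable fun p : V3 × V3 => ENNReal.ofReal (1 + ‖p.1‖ ^ 2 + ‖p.2‖ ^ 2) := by
  fun_prop

/-- Pointwise: `‖w − v‖ (1 + ‖v‖² + ‖w‖²) ≤ (3/2 + 3‖v‖⁴) + (3/2 + 3‖w‖⁴)`. -/
theorem fluxMark_energy_le (v w : V3) :
    ‖w - v‖ * (1 + ‖v‖ ^ 2 + ‖w‖ ^ 2) ≤ (3 / 2 + 3 * ‖v‖ ^ 4) + (3 / 2 + 3 * ‖w‖ ^ 4) := by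
  have hA := norm_nonneg v
  have hB := norm_nonneg w
  have h1 : ‖w - v‖ ≤ ‖v‖ + ‖w‖ := by rw [norm_sub_rev]; exact norm_sub_le v w
  have h2 : ‖v‖ + ‖w‖ ≤ 1 + ‖v‖ ^ 2 + ‖w‖ ^ 2 := by nlinarith [sq_nonneg (‖v‖ - 1), sq_nonneg (‖w‖ - 1)]
  have hS : 0 ≤ 1 + ‖v‖ ^ 2 + ‖w‖ ^ 2 := by positivity
  calc ‖w - v‖ * (1 + ‖v‖ ^ 2 + ‖w‖ ^ 2) ≤ (1 + ‖v‖ ^ 2 + ‖w‖ ^ 2) * (1 + ‖v‖ ^ 2 + ‖w‖ ^ 2) :=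
        mul_le_mul_of_nonneg_right (h1.trans h2) hS
    _ ≤ (3 / 2 + 3 * ‖v‖ ^ 4) + (3 / 2 + 3 * ‖w‖ ^ 4) := by
        nlinarith [sq_nonneg (‖v‖ ^ 2 - ‖w‖ ^ 2), sq_nonneg (‖v‖ ^ 2 - 1), sq_nonneg (‖w‖ ^ 2 - 1)]

/-- **The Gaussian flux integral of the energy mark is finite**: `∫ ‖w − v‖ (1 + ‖v‖² + ‖w‖²) dN(u,θ)^{⊗2} < ∞`
(fourth Gaussian moments; marginals of the product law). -/
theorem lintegral_fluxMark_energy_ne_top (u : V3) (θ : ℝ) :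
    ∫⁻ p, ENNReal.ofReal ‖p.2 - p.1‖ * ENNReal.ofReal (1 + ‖p.1‖ ^ 2 + ‖p.2‖ ^ 2)
        ∂((gaussMeasure u θ).prod (gaussMeasure u θ)) ≠ ∞ := by
  -- adapted from `mmr_lintegral_energyMark_prod_gaussMeasure_le` (`…RelayRaceLocalityRestartPrincipleMmrEnergyHypConst`)
  set γ := gaussMeasure u θ with hγ
  set g : V3 → ℝ≥0∞ := fun v => ENNReal.ofReal (3 / 2 + 3 * ‖v‖ ^ 4) with hg
  have hgm : Measurable g := by rw [hg]; fun_prop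
  have hle : ∀ p : V3 × V3,
      ENNReal.ofReal ‖p.2 - p.1‖ * ENNReal.ofReal (1 + ‖p.1‖ ^ 2 + ‖p.2‖ ^ 2) ≤ g p.1 + g p.2 := by
    intro p
    rw [hg, ← ENNReal.ofReal_mul (norm_nonneg _), ← ENNReal.ofReal_add (by positivity) (by positivity)]
    exact ENNReal.ofReal_le_ofReal (fluxMark_energy_le p.1 p.2)
  have h1 : ∫⁻ p, g p.1 ∂(γ.prod γ) = ∫⁻ v, g v ∂γ := by
    calc ∫⁻ p, g p.1 ∂(γ.prod γ) = ∫⁻ v, ∫⁻ _w, g v ∂γ ∂γ := lintegral_prod _ (hgm.comp measurable_fst).aemeasurable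
      _ = ∫⁻ v, g v ∂γ := by simp only [lintegral_const, measure_univ, mul_one]
  have h2 : ∫⁻ p, g p.2 ∂(γ.prod γ) = ∫⁻ v, g v ∂γ := by
    calc ∫⁻ p, g p.2 ∂(γ.prod γ) = ∫⁻ _v, ∫⁻ w, g w ∂γ ∂γ := lintegral_prod _ (hgm.comp measurable_snd).aemeasurable
      _ = ∫⁻ v, g v ∂γ := by simp only [lintegral_const, measure_univ, mul_one]
  have h4 : Integrable (fun v : V3 => ‖v‖ ^ 4) γ := (IsGaussian.memLp_id _ 4 (by simp)).integrable_norm_pow (by norm_num)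
  have hint : Integrable (fun v : V3 => 3 / 2 + 3 * ‖v‖ ^ 4) γ := (integrable_const _).add (h4.const_mul 3)
  have h3 : ∫⁻ v, g v ∂γ ≠ ∞ := hint.lintegral_lt_top.ne
  refine ne_top_of_le_ne_top (ENNReal.add_ne_top.2 ⟨h3, h3⟩) ?_
  calc ∫⁻ p, ENNReal.ofReal ‖p.2 - p.1‖ * ENNReal.ofReal (1 + ‖p.1‖ ^ 2 + ‖p.2‖ ^ 2) ∂(γ.prod γ)
      ≤ ∫⁻ p, (g p.1 + g p.2) ∂(γ.prod γ) := lintegral_mono hle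
    _ = ∫⁻ v, g v ∂γ + ∫⁻ v, g v ∂γ := by
        rw [lintegral_add_left (show Measurable (fun p : V3 × V3 => g p.1) from hgm.comp measurable_fst), h1, h2]

/-! ## The rung for `collCount` -/

/-- **FEW COLLISIONS AT EQUILIBRIUM (the `m = 0` rung of S0 `stub_fewCollisions`).** At constant profiles
`(a, θ, u)` with `0 < a`, `0 < θ`, for every `0 < σ < 1/2`, every hard-sphere flow family and every horizon `t > 0`:
`FewCollisionsOn σ (fun _ => a) (fun _ => θ) (fun _ => u) Φ t` — unconditionally (no `TailsOn`). Quantitatively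
`P_N{(N+1)^{4/3+p} < collCount} ≤ 20 t σ² (N+1)^{-p} ∫ ‖w − v‖ (1 + ‖v‖² + ‖w‖²) dN(u,θ)^{⊗2}` for `N ≥ 1`. -/
theorem fewCollisionsOn_const (a θ : ℝ) (u : V3) (ha : 0 < a) (hθ : 0 < θ) {σ : ℝ} (hσ : 0 < σ) (hσ' : σ < 2⁻¹)
    (Φ : Flows σ) {t : ℝ} (ht : 0 < t) : FewCollisionsOn σ (fun _ => a) (fun _ => θ) (fun _ => u) Φ t :=
  fun _ hp => tendsto_measure_gt_rpow_of_markSum hσ hσ' ha hθ u Φ ht measurable_energyMark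
    (lintegral_fluxMark_energy_ne_top u θ) (fun N z => collCount σ N (Φ N) t z)
    (fun N => aemeasurable_ofReal_collCount hσ hσ' _ _ _ (Φ N) t)
    (fun N _ hz => ofReal_collCount_le_markSum (Φ N) hz t) hp

/-- Registration anchor of this helper file (`--supports stmt-AtomisticToContinuum-14868`, equilibrium rung of
`stub_fewCollisions`): few collisions at constant profiles, for every `0 < σ < 1/2`, every flow family and every
horizon, with no hypothesis. -/
theorem bhFewCollisions_eqRung_anchor : ∀ (a θ : ℝ) (u : V3), 0 < a → 0 < θ → ∀ σ : ℝ, 0 < σ → σ < 2⁻¹ → ∀ (Φ : Flows σ) (t : ℝ), 0 < t → FewCollisionsOn σ (fun _ => a) (fun _ => θ) (fun _ => u) Φ t :=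
  fun a θ u ha hθ _ hσ hσ' Φ _ ht => fewCollisionsOn_const a θ u ha hθ hσ hσ' Φ ht

end FewCollisions

end

end Summit.AtomisticToContinuum.HydrodynamicLimit.Theorems.BlockHDissipation
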